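/-
Copyright: the b2b-balaban cell (near-miss cell 7), T⁴-continuum fan-out; row NE7b ROUND-2 swarm, seat
t4-ne7b-formalise-leaf-05 gen 4 (row S6g′ INSTANCE of `t4/b2b-balaban-t4-ne7b-p1/LEAVES-NE7b.md`, owner's rulings
R-OWNER-22-22 (route (α), wiring (α′)) ∕ -23 ∕ -24, ACK l.12945: «the twin END»).  Released under the licence of the
surrounding project.
-/
import Summits.QuantumFields.BalabanUV.T4Continuum.Support.HistoryJoinsPlacedLaws
import Summits.QuantumFields.BalabanUV.T4Continuum.Support.HistoryJoinsSortTwin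
import Summits.QuantumFields.BalabanUV.T4Continuum.Support.HistoryZoneMassTotalFlat

/-!
# The count's END for the concrete zone ON THE SORTED FLAT TWIN of a realised pedigree
# (row S6g′ INSTANCE, «THE TWIN END»)

Summits-side support leaf of the T⁴-continuum cell (rung (B)+1 on a FINITE torus only; NOT infinite volume, NOT the
mass gap, NOT the Clay statement; NOT a proof of the spine estimate NE7b).  Row NE7b, route «COUNT», row S6g′.
[folklore] COMPOSITION BY NAME of file B2's END for the concrete zone (`HistoryJoinsPlacedLaws.card_S_le_exp_pow_zoneP`)
at the counted member of route (α) — leaf-10 gen 3's SORTED FLAT TWIN `P.sortR.gen c` of a pedigree `P` — with the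
dating ∕ chronology of the flat genealogy (`HistoryZoneMassTotalFlat.dated_gen` ∕ `chronoZ_gen`, free under «oldest
line first»), gen 3's entropy input (`HistoryJoinsSortTwin.ENT_le_gen_sortR`) and leaf-10 gen 3's invariances of the
class-linear letters under sorting (`HistorySiblingEntropySortInv.bsum_gen_sortR` ∕ `partnerAges_gen_sortR` ∕
`mrg_gen_sortR`).  Nothing is quoted from print, nothing printed is asserted, no `[cite:]` tag, no `Prop` fact minted,
no definition.

WHAT.
* `hENT_sortR`: the END's entropy binder for `G := P.sortR.gen c` in its own letters:
  `ENT step (P.sortR.gen c) ≤ 10·F + 4·partnerAges + (8∕φ)·totalCostT Prod.fst C K R (P.genT c)`,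
  `F = bsum (fat + 1) (P.sortR.gen c)` (`κE = 10 = 2 + 8`, the `8·mrg` absorbed by `mrg ≤ F − 1`; `μE = 4`);
* **`card_S_sortR_le_exp_pow`** — THE TWIN END: for a pedigree `P` read «oldest line first» (`HeadOldest`) with dated
  renewals (`RenewDated`) and forest ancestries (`Forest`), a component `c` of step `≤ K` whose realised TAGGED member
  is `ConsistentTLE` (H1b), floors `≥ φ > 0` on the run, and the zone-side letters of file B2 (`1 ≤ L`, `1 ≤ n`,
  `LevelFn K lv`, stride∕advance∕smallness∕decay):
  `#S (zoneP …) ρ c₀ step (P.sortR.gen c) z ≤ exp((2 + κM + κρ + 10)·bsum (fat+1) (P.gen c) + (8∕φ)·totalCostT … (P.genT c))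
     · (L^d·e^4)^{partnerAges step (P.gen c)}`
  for EVERY root datum `z` (anchor cell, template) — the class-linear letters are those of the REALISED flat member
  `P.gen c` (equal to the twin's), the slack is the realised tagged member's booked cost.
What T3b adds (next file): the map «physical history in the slot ↦ counted placement of the twin» (R-OWNER-23-3∕-4:
order-free occupant key, `HistoryJoinsGlue.exists_rearranged_mem_S`), giving S12e's `hmult`.

HONEST SCOPE.  Composition over OUR carriers; displayed with named suppliers: `HeadOldest`∕`RenewDated`∕`Forest`
(reading conventions of the realised pedigree), `ConsistentTLE` of the tagged member (H1b), the floor bound (flow), the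
zone-side side conditions (symbolic, trigger c2∕c6); nothing of H3∕(B)∕BetaPertH touched; `BirthShapeNodup` NOT retired
here; NE7b NOT proved.  HONEST DEPENDENCY (cell): continuum YM on T⁴ ⇐ BetaPertH ∧ nine spine estimates (0/9 proved);
BetaPertH ⇐ (D1) ∧ (D4) ∧ CAP+tail; G-an2-4 gates asym, D1 and NE2/3/4.  This file changes none of it.
-/

open Finset
open Literature.MathematicalPhysics.QuantumFieldTheory.Balaban1983to89
open T4PersistenceDictionary T4PrintedShapeBanking T4TaggedShapeBanking T4PartnerMultiplicity T4BranchingRecordsGas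
open Summit.QuantumFields.BalabanUV.T4Continuum.ZoneTorus
open Summit.QuantumFields.BalabanUV.T4Continuum.ZoneSkeleton
open Summit.QuantumFields.BalabanUV.T4Continuum.HistoryZones
open Summit.QuantumFields.BalabanUV.T4Continuum.HistoryZoneEvolve
open Summit.QuantumFields.BalabanUV.T4Continuum.HistoryZoneMassJoins
open Summit.QuantumFields.BalabanUV.T4Continuum.HistoryZoneMassTotalFlat
open Summit.QuantumFields.BalabanUV.T4Continuum.HistoryBankingLE
open Summit.QuantumFields.BalabanUV.T4Continuum.HistoryJoins
open Summit.QuantumFields.BalabanUV.T4Continuum.HistoryJoinsAdm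
open Summit.QuantumFields.BalabanUV.T4Continuum.HistoryJoinsBudget (mrg)
open Summit.QuantumFields.BalabanUV.T4Continuum.HistoryJoinsEntropyBudget (ENT)
open Summit.QuantumFields.BalabanUV.T4Continuum.HistoryJoinsEnd
open Summit.QuantumFields.BalabanUV.T4Continuum.HistoryGen
open Summit.QuantumFields.BalabanUV.T4Continuum.HistorySiblingEntropyBridge
open Summit.QuantumFields.BalabanUV.T4Continuum.HistoryJoinsSortTwin
open Summit.QuantumFields.BalabanUV.T4Continuum.HistoryRegionTemplates
open Summit.QuantumFields.BalabanUV.T4Continuum.HistoryJoinsTemplates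
open Summit.QuantumFields.BalabanUV.T4Continuum.HistoryJoinsPlacedZone
open Summit.QuantumFields.BalabanUV.T4Continuum.HistoryJoinsPlacedLaws

namespace Summit.QuantumFields.BalabanUV.T4Continuum.HistoryJoinsPlacedTwin

noncomputable section

open scoped Classical

variable {α π : Type*} [DecidableEq α] [DecidableEq π] (P : Pedigree α π)

/-- **THE ENTROPY BINDER ON THE SORTED TWIN IN THE END's LETTERS**: `κE = 10`, `μE = 4`, slack
`Ξ = (8∕φ)·totalCostT Prod.fst C K R (P.genT c)`. [folklore] -/
theorem hENT_sortR (hH : ∀ c, P.HeadOldest c) (hR : P.RenewDated) (hF : ∀ c, P.Forest c)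
    {C : T4PrintedShapeBanking.Consts} {K : ℕ} {R : ℕ → ℕ} (hE₂ : 0 ≤ C.E₂) (hE₃ : 0 ≤ C.E₃) {φ : ℝ} (hφ0 : 0 < φ)
    (hφ : ∀ n, n ≤ K → φ ≤ floorK C K R n) (c : α) (hc : ConsistentTLE Prod.fst C K R (P.genT c)) :
    ENT PEv.step (P.sortR.gen c) ≤
      10 * bsum (fun b => ((b.fat : ℕ) : ℝ) + 1) (P.sortR.gen c) + 4 * (partnerAges PEv.step (P.sortR.gen c) : ℝ) +
        8 / φ * totalCostT Prod.fst C K R (P.genT c) := by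
  have h := ENT_le_gen_sortR P hH hR hF hE₂ hE₃ hφ0 hφ c hc
  rw [bsum_gen_sortR P _ hH c, partnerAges_gen_sortR P hH c]
  have hb : bsum (fun b => (1 : ℝ) + PEv.fat b) (P.gen c) = bsum (fun b => ((b.fat : ℕ) : ℝ) + 1) (P.gen c) := by
    congr 1; funext b; rw [add_comm]
  have hm := mrg_le_bsum PEv.step PEv.fat (P.gen c)
  rw [hb] at h
  have hm' : mrg PEv.step (P.gen c) ≤ bsum (fun b => ((b.fat : ℕ) : ℝ) + 1) (P.gen c) := by
    have : bsum (fun b => ((PEv.fat b : ℕ) : ℝ) + 1) (P.gen c) = bsum (fun b => ((b.fat : ℕ) : ℝ) + 1) (P.gen c) := rfl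
    linarith
  linarith

variable {d n L K D M : ℕ} {lv : ℕ → ℕ} {c : ℕ} {c₀ : TCell d (n * L ^ K) × Template d M}
  {R' : Type*} [LinearOrder R'] (ρ : (Addr D → TCell d (n * L ^ K) × Template d M) → R')

/-- **ROW S6g′ INSTANCE — THE TWIN END.**  For a pedigree `P` read «oldest line first» with dated renewals and forest
ancestries, a component `cc` of step `≤ K` whose realised tagged member is `ConsistentTLE` (H1b), floors `≥ φ > 0`,
and the zone-side letters of file B2: for EVERY root datum `z`,
`#S (zoneP …) ρ c₀ step (P.sortR.gen cc) z ≤ exp((2 + κM + κρ + 10)·bsum (fat+1) (P.gen cc) + (8∕φ)·T)·(L^d·e^4)^{partnerAges}`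
with the class-linear letters of the REALISED flat member `P.gen cc` and `T = totalCostT Prod.fst C K R (P.genT cc)`.
[folklore] -/
theorem card_S_sortR_le_exp_pow (hH : ∀ c, P.HeadOldest c) (hR : P.RenewDated) (hF : ∀ c, P.Forest c)
    {C : T4PrintedShapeBanking.Consts} {R : ℕ → ℕ} (hE₂ : 0 ≤ C.E₂) (hE₃ : 0 ≤ C.E₃) {φ : ℝ} (hφ0 : 0 < φ)
    (hφ : ∀ m, m ≤ K → φ ≤ floorK C K R m) (cc : α) (hc : ConsistentTLE Prod.fst C K R (P.genT cc))
    (hK : P.step cc ≤ K)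
    (hL : 1 ≤ L) (hn : 1 ≤ n) (hlv : LevelFn K lv)
    {s m : ℕ} (hs : 1 ≤ s) (hm : ∀ u : ℕ, u + s ≤ K → lv u + m ≤ lv (u + s))
    (hsmall : (((2 * cth c 1 s + 1) ^ d : ℕ) : ℝ) * (5 : ℝ) ^ d * ((max 1 (2 * c + 2) : ℕ) : ℝ) ≤ (L : ℝ) ^ m / 2)
    {θ : ℝ} (hθ0 : 0 ≤ θ) (hθ1 : θ < 1) (hθs : 1 / 2 ≤ θ ^ s)
    (z : TCell d (n * L ^ K) × Template d M) :
    ((S (zoneP n L K lv c c₀) ρ c₀ PEv.step (P.sortR.gen cc) z).card : ℝ) ≤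
      Real.exp ((2 +
            ((2 * (((2 * cth c 1 s + 1) ^ d : ℕ) : ℝ) * ((((2 * c + 1) ^ d : ℕ) : ℝ) * (4 * 2 ^ d)) +
                  4 * ((((2 * cth c 1 s + 1) ^ d : ℕ) : ℝ) * (5 : ℝ) ^ d)) / (1 - θ) +
              2 * (2 * ((((2 * cth c 1 s + 1) ^ d : ℕ) : ℝ) * (5 : ℝ) ^ d))) +
            (2 * ((0 + 2 * Real.log (2 * d + 1)) + (2 * (d : ℝ) + 2 * Real.log (2 * d + 1)) *
                  (((max 1 (2 * c + 2) : ℕ) : ℝ) * (2 * ((((2 * cth c 1 s + 1) ^ d : ℕ) : ℝ) * (5 : ℝ) ^ d)))) +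
              (2 * (d : ℝ) + 2 * Real.log (2 * d + 1)) * 1 *
                (((max 1 (2 * c + 2) : ℕ) : ℝ) *
                    ((2 * (((2 * cth c 1 s + 1) ^ d : ℕ) : ℝ) * ((((2 * c + 1) ^ d : ℕ) : ℝ) * (4 * 2 ^ d)) +
                        4 * ((((2 * cth c 1 s + 1) ^ d : ℕ) : ℝ) * (5 : ℝ) ^ d)) / (1 - θ)) +
                  4 * 2 ^ d)) +
            10) * bsum (fun b => ((b.fat : ℕ) : ℝ) + 1) (P.gen cc) + 8 / φ * totalCostT Prod.fst C K R (P.genT cc)) *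
        (((L : ℝ) ^ d) * Real.exp 4) ^ partnerAges PEv.step (P.gen cc) := by
  have hDt : Dated PEv.step true (P.step cc + 1) (P.sortR.gen cc) :=
    dated_gen (P := P.sortR) (headOldest_sortR P hH) cc (Nat.lt_succ_self _)
  have hCh : Chrono PEv.step (P.sortR.gen cc) := chronoZ_gen (P := P.sortR) (headOldest_sortR P hH) cc
  have h := card_S_le_exp_pow_zoneP (c := c) (c₀ := c₀) ρ hL hn hlv hDt (by omega) hCh hs hm hsmall hθ0 hθ1 hθs
    (hENT_sortR P hH hR hF hE₂ hE₃ hφ0 hφ cc hc) z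
  rw [bsum_gen_sortR P _ hH cc, partnerAges_gen_sortR P hH cc] at h
  exact h

end

end Summit.QuantumFields.BalabanUV.T4Continuum.HistoryJoinsPlacedTwin
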